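import Mathlib
import HarnessLib
import Summits.HubbardSuperconductivity.HubbardSuperconductivity.Theorems.KLProgrammeKLRegimeEngineFrameShiftMomentResponseCTSplit

/-!
# K3 gen-8-FLOW (stmt 20437, stub (C), located risk «(C)-B-REP» item (β)): the split door in the `selfEnergy` normalisation

Cell gate-hubbard-kl, seat p2 g12.  `selfEnergy = 2·βL²·kernel₂` at the reading string, for ANY action; so `…MomentResponseCTSplit.covRespCT_moment_kernel_two_sub_le_split`
reads: **`selfEnergyCT_moment_sub_le_split`** — `Σ_x w(x)‖𝔉⁻¹[k⃗ ↦ Σ[𝒲′[s₁]]((ω_i,k⃗),σ) − Σ[𝒲′[s₀]]((ω_i,k⃗),σ)](x)‖ ≤ 2|β|L²·(12·(Σ_p‖(s₁−s₀) p‖)·N₂ +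
w(0)·(|U|/|βL²|³)·Ss + 2·D·S²)`, `𝒲′[s] = effAction (normalCovariance s) (V_U + 𝒩_K)` (proof = `selfEnergy_moment_sub_le`'s, p536707).  This is the form the
jets-from-moments lemma `norm_iteratedFDeriv_evalM_symInterp_le_of_moments` consumes (cf. p550489 for the pure-quartic representation).
Proofs only; nothing asserts superconductivity.  References: Salmhofer 1998 §3.1; BGM 2006 §3 (3.3) [cite: BenfattoGiulianiMastropietro2006].
-/

noncomputable section

namespace Summit.HubbardSuperconductivity.HubbardSuperconductivity.Theorems.EngineV8

set_option linter.dupNamespace false -- summit = problem name (single-conjunct summit), D-0017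

open Finset Literature.MathematicalPhysics.QuantumLattice Literature.Probability.LatticeModels GrassmannAlgebra
open Summit.HubbardSuperconductivity.HubbardSuperconductivity.Theorems.KLRegimeSplit

variable {L M : ℕ} [NeZero L]

/-- **The split response door for `V_U + 𝒩_K` in the `selfEnergy` normalisation.** -/
theorem selfEnergyCT_moment_sub_le_split (s₀ s₁ : FreqMomentum L M × Fin 2 → ℂ) (β U : ℝ) (K : TrigPolyC4v) (i : MatsubaraIdx M) (σ : Fin 2)
    {w : TorusSite 2 L → ℝ} (hw0 : ∀ x, 0 ≤ w x) (hw : ∀ x y, w (x + y) ≤ w x * w y)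
    (hZ : ∀ t ∈ Set.Icc (0 : ℝ) 1, effPartitionFn ℂ (normalCovariance L M s₀ + ((t : ℂ)) • (normalCovariance L M s₁ - normalCovariance L M s₀))
      (hubbardInteraction L M β U + counterQuadratic L M β K) ≠ 0)
    {N₂ Ss S D : ℝ}
    (hN₂ : ∀ t ∈ Set.Icc (0 : ℝ) 1, ∀ A : HubbardFieldIdx L M, ∑ x, w x * ‖torusFourierInv (fun kv : TorusSite 2 L =>
      kernel ℂ (effAction ℂ (normalCovariance L M s₀ + ((t : ℂ)) • (normalCovariance L M s₁ - normalCovariance L M s₀))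
        (hubbardInteraction L M β U + counterQuadratic L M β K)) 4
        (Fin.snoc (Fin.snoc ![((((i, kv), σ), 0) : HubbardFieldIdx L M), (((i, kv), σ), 1)] (A.1, 1 - A.2) : Fin 3 → HubbardFieldIdx L M) A) -
      kernel ℂ (hubbardInteraction L M β U) 4
        (Fin.snoc (Fin.snoc ![((((i, kv), σ), 0) : HubbardFieldIdx L M), (((i, kv), σ), 1)] (A.1, 1 - A.2) : Fin 3 → HubbardFieldIdx L M) A)) x‖ ≤ N₂)
    (hSs : ∀ τ : Fin 2, ‖∑ p : FreqMomentum L M, (s₁ (p, τ) - s₀ (p, τ))‖ ≤ Ss)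
    (hS : ∀ t ∈ Set.Icc (0 : ℝ) 1, ∑ x, w x * ‖torusFourierInv (fun kv : TorusSite 2 L =>
      kernel ℂ (effAction ℂ (normalCovariance L M s₀ + ((t : ℂ)) • (normalCovariance L M s₁ - normalCovariance L M s₀))
        (hubbardInteraction L M β U + counterQuadratic L M β K)) 2 ![((((i, kv), σ), 0) : HubbardFieldIdx L M), (((i, kv), σ), 1)]) x‖ ≤ S)
    (hD : ∑ x, w x * ‖torusFourierInv (fun kv : TorusSite 2 L => s₁ ((i, kv), σ) - s₀ ((i, kv), σ)) x‖ ≤ D) :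
    ∑ x, w x * ‖torusFourierInv (fun kv : TorusSite 2 L =>
        selfEnergy L M β (effAction ℂ (normalCovariance L M s₁) (hubbardInteraction L M β U + counterQuadratic L M β K)) (i, kv) σ -
          selfEnergy L M β (effAction ℂ (normalCovariance L M s₀) (hubbardInteraction L M β U + counterQuadratic L M β K)) (i, kv) σ) x‖ ≤
      2 * (|β| * (L : ℝ) ^ 2) * (12 * (∑ p, ‖s₁ p - s₀ p‖) * N₂ + w 0 * (|U| / |β * (L : ℝ) ^ 2| ^ 3) * Ss + 2 * D * S ^ 2) := by
  have h := covRespCT_moment_kernel_two_sub_le_split s₀ s₁ β U K i σ hw0 hw hZ hN₂ hSs hS hD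
  set c : ℂ := ((((2 : ℕ).factorial : ℝ) * (β * (L : ℝ) ^ 2) ^ (2 - 1) : ℝ) : ℂ) with hc
  have hcn : ‖c‖ = 2 * (|β| * (L : ℝ) ^ 2) := by
    rw [hc, Complex.norm_real, Real.norm_eq_abs, Nat.factorial_two]
    simp [abs_mul, abs_pow]
  have hfun : (fun kv : TorusSite 2 L =>
        selfEnergy L M β (effAction ℂ (normalCovariance L M s₁) (hubbardInteraction L M β U + counterQuadratic L M β K)) (i, kv) σ -
          selfEnergy L M β (effAction ℂ (normalCovariance L M s₀) (hubbardInteraction L M β U + counterQuadratic L M β K)) (i, kv) σ) =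
      fun kv => c * (kernel ℂ (effAction ℂ (normalCovariance L M s₁) (hubbardInteraction L M β U + counterQuadratic L M β K)) 2
            ![((((i, kv), σ), 0) : HubbardFieldIdx L M), (((i, kv), σ), 1)] -
          kernel ℂ (effAction ℂ (normalCovariance L M s₀) (hubbardInteraction L M β U + counterQuadratic L M β K)) 2
            ![((((i, kv), σ), 0) : HubbardFieldIdx L M), (((i, kv), σ), 1)]) := by
    funext kv
    rw [selfEnergy, selfEnergy, vertexFn_def, vertexFn_def, ← hc, ← mul_sub]
  rw [hfun]
  simp_rw [torusFourierInv_const_mul, norm_mul, hcn]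
  calc ∑ x, w x * (2 * (|β| * (L : ℝ) ^ 2) * ‖torusFourierInv (fun kv : TorusSite 2 L =>
          kernel ℂ (effAction ℂ (normalCovariance L M s₁) (hubbardInteraction L M β U + counterQuadratic L M β K)) 2
              ![((((i, kv), σ), 0) : HubbardFieldIdx L M), (((i, kv), σ), 1)] -
            kernel ℂ (effAction ℂ (normalCovariance L M s₀) (hubbardInteraction L M β U + counterQuadratic L M β K)) 2
              ![((((i, kv), σ), 0) : HubbardFieldIdx L M), (((i, kv), σ), 1)]) x‖)
      = 2 * (|β| * (L : ℝ) ^ 2) * ∑ x, w x * ‖torusFourierInv (fun kv : TorusSite 2 L =>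
          kernel ℂ (effAction ℂ (normalCovariance L M s₁) (hubbardInteraction L M β U + counterQuadratic L M β K)) 2
              ![((((i, kv), σ), 0) : HubbardFieldIdx L M), (((i, kv), σ), 1)] -
            kernel ℂ (effAction ℂ (normalCovariance L M s₀) (hubbardInteraction L M β U + counterQuadratic L M β K)) 2
              ![((((i, kv), σ), 0) : HubbardFieldIdx L M), (((i, kv), σ), 1)]) x‖ := by
        rw [mul_sum]; exact sum_congr rfl fun x _ => by ring
    _ ≤ 2 * (|β| * (L : ℝ) ^ 2) * (12 * (∑ p, ‖s₁ p - s₀ p‖) * N₂ + w 0 * (|U| / |β * (L : ℝ) ^ 2| ^ 3) * Ss + 2 * D * S ^ 2) := mul_le_mul_of_nonneg_left h (by positivity)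

end Summit.HubbardSuperconductivity.HubbardSuperconductivity.Theorems.EngineV8

end
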